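import Summits.Ventures.DiscreteObjects.UnitDistance.PlaneLowerBoundFive
import Mathlib.Data.ZMod.Basic
import HarnessLib

/-!
# `χ(ℝ²) ≤ 7` IN THE KERNEL: the hexagonal 7-colouring (Isbell 1950; Hadwiger 1945), so `5 ≤ χ(ℝ²) ≤ 7` is a kernel statement

Framing (verbatim for the cell): lottery ticket; floor = certified bounds/negative ranges.

The classical upper bound of the Hadwiger–Nelson problem (see de Grey, arXiv:1804.02385 §1; Soifer, *The Mathematical Coloring Book* ch. 2): colour
the plane by the cells of a hexagonal tiling with 7 colours so that equal colours are either in one cell (diameter `< 1`) or in cells more than `1`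
apart.  KERNEL VERSION (`planeC_colorable_seven`, `chromaticNumber_plane_le_seven`, `plane_chromaticNumber_bounds`; standard axioms, no data):
let `Λ = d(ℤ + ℤω)`, `ω = e^{iπ/3}`, `d = 3/4`; every point `z = d(x + yω)` is sent to a lattice point `d(m + nω)` among the four corners of its
floor-parallelogram with `(x−m)² + (x−m)(y−n) + (y−n)² ≤ 1/3` (`hexRound`; such a corner exists because the parallelogram is two equilateral triangles
of circumradius `1/√3` — `min3_errF_le`), and coloured `(m − 2n) mod 7` (`hexColour`).  Equal colours: either the same lattice point — then
`‖z − w‖ ≤ 2·d/√3 = √3/2 < 1` — or lattice points differing by `d(Δm + Δnω)` with `7 ∣ Δm − 2Δn`, whence `Δm² + ΔmΔn + Δn² ≥ 7` (`seven_le_form`: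
the form is `7(Δn² + 5kΔn + 7k²)` for `Δm = 2Δn + 7k`) and `‖z − w‖ ≥ d√7 − 2d/√3 > 1`.  All inequalities are closed by `nlinarith` on squared
norms (no square roots are compared).  Transfer to `planeUnitDistanceGraph` along `Complex.orthonormalBasisOneI` as in `PlaneLowerBoundFive.lean`.
Classical theorem; formalisation the cell's (seat udg g9); no novelty claimed.
-/

namespace Summit.Ventures.DiscreteObjects.UnitDistance

open Complex

/-- The binary quadratic form `a² + ab + b²` (squared length of `a + bω`). -/
def errF (a b : ℝ) : ℝ := a * a + a * b + b * b

/-- `a² + ab + b² ≥ ¾·a²` and `≥ ¾·b²`; in particular it is non-negative. -/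
theorem errF_lower (a b : ℝ) : 3 / 4 * (a * a) ≤ errF a b ∧ 3 / 4 * (b * b) ≤ errF a b := by
  unfold errF
  constructor
  · nlinarith [sq_nonneg (b + a / 2)]
  · nlinarith [sq_nonneg (a + b / 2)]

/-- Covering lemma, lower triangle: for `a, b ≥ 0`, `a + b ≤ 1` one of the corners `(0,0), (1,0), (0,1)` is within form-distance `1/3`. -/
theorem min3_errF_le (a b : ℝ) (ha : 0 ≤ a) (hb : 0 ≤ b) (hab : a + b ≤ 1) :
    errF a b ≤ 1 / 3 ∨ errF (a - 1) b ≤ 1 / 3 ∨ errF a (b - 1) ≤ 1 / 3 := by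
  by_contra h
  push Not at h
  obtain ⟨h0, h1, h2⟩ := h
  -- barycentric average of the three form-distances is `a + b − a² − ab − b² = 1/3 − errF (a − 1/3) (b − 1/3) ≤ 1/3`
  have key : (1 - a - b) * errF a b + a * errF (a - 1) b + b * errF a (b - 1) = 1 / 3 - errF (a - 1 / 3) (b - 1 / 3) := by
    unfold errF; ring
  have w0 : 0 ≤ 1 - a - b := by linarith
  have p0 : (1 - a - b) * (1 / 3) ≤ (1 - a - b) * errF a b := mul_le_mul_of_nonneg_left h0.le w0
  have p1 : a * (1 / 3) ≤ a * errF (a - 1) b := mul_le_mul_of_nonneg_left h1.le ha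
  have p2 : b * (1 / 3) ≤ b * errF a (b - 1) := mul_le_mul_of_nonneg_left h2.le hb
  have hE : errF (a - 1 / 3) (b - 1 / 3) ≤ 0 := by linarith
  obtain ⟨l1, l2⟩ := errF_lower (a - 1 / 3) (b - 1 / 3)
  have ha3 : a = 1 / 3 := by nlinarith [sq_nonneg (a - 1 / 3)]
  have hb3 : b = 1 / 3 := by nlinarith [sq_nonneg (b - 1 / 3)]
  subst ha3; subst hb3
  norm_num [errF] at h0

/-- Covering lemma, upper triangle (`a + b ≥ 1`, `a, b ≤ 1`): one of the corners `(1,0), (0,1), (1,1)` is within form-distance `1/3`. -/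
theorem min3_errF_le' (a b : ℝ) (ha : a ≤ 1) (hb : b ≤ 1) (hab : 1 ≤ a + b) :
    errF (a - 1) (b - 1) ≤ 1 / 3 ∨ errF a (b - 1) ≤ 1 / 3 ∨ errF (a - 1) b ≤ 1 / 3 := by
  have h := min3_errF_le (1 - a) (1 - b) (by linarith) (by linarith) (by linarith)
  have e1 : errF (1 - a) (1 - b) = errF (a - 1) (b - 1) := by unfold errF; ring
  have e2 : errF (1 - a - 1) (1 - b) = errF a (b - 1) := by unfold errF; ring
  have e3 : errF (1 - a) (1 - b - 1) = errF (a - 1) b := by unfold errF; ring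
  rw [e1, e2, e3] at h
  exact h

/-! ## The lattice, the rounding and the colouring -/

/-- Lattice spacing `d = 3/4`. -/
noncomputable def dHex : ℝ := 3 / 4

/-- The point `d·(u + vω)` of the plane, `ω = (1 + i√3)/2`, for real lattice coordinates `u, v`. -/
noncomputable def latC (u v : ℝ) : ℂ := ⟨dHex * (u + v / 2), dHex * (v * Real.sqrt 3 / 2)⟩

/-- `latC` is additive (used on differences). -/
theorem latC_sub (u v u' v' : ℝ) : latC u v - latC u' v' = latC (u - u') (v - v') := by
  apply Complex.ext <;> simp [latC] <;> ring

/-- Squared length of `d·(u + vω)` is `d²·(u² + uv + v²)`. -/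
theorem normSq_latC (u v : ℝ) : Complex.normSq (latC u v) = dHex ^ 2 * errF u v := by
  rw [latC, Complex.normSq_mk, errF]
  have h3 : Real.sqrt 3 * Real.sqrt 3 = 3 := Real.mul_self_sqrt (by norm_num)
  linear_combination (dHex ^ 2 * v * v / 4) * h3

/-- Second lattice coordinate of `z`. -/
noncomputable def latY (z : ℂ) : ℝ := 2 * z.im / (dHex * Real.sqrt 3)
/-- First lattice coordinate of `z`. -/
noncomputable def latX (z : ℂ) : ℝ := z.re / dHex - latY z / 2

/-- Every point is `d·(x + yω)` for its lattice coordinates. -/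
theorem latC_latX_latY (z : ℂ) : latC (latX z) (latY z) = z := by
  have hd : dHex ≠ 0 := by norm_num [dHex]
  have hs : Real.sqrt 3 ≠ 0 := by positivity
  apply Complex.ext
  · simp only [latC, latX]; field_simp; ring
  · simp only [latC, latY]; field_simp

/-- The chosen lattice point of `z`: a corner `(m, n)` of the floor-parallelogram of `(x, y)` with `errF (x − m) (y − n) ≤ 1/3`. -/
noncomputable def hexRound (z : ℂ) : ℤ × ℤ :=
  if errF (latX z - ⌊latX z⌋) (latY z - ⌊latY z⌋) ≤ 1 / 3 then (⌊latX z⌋, ⌊latY z⌋)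
  else if errF (latX z - ⌊latX z⌋ - 1) (latY z - ⌊latY z⌋) ≤ 1 / 3 then (⌊latX z⌋ + 1, ⌊latY z⌋)
  else if errF (latX z - ⌊latX z⌋) (latY z - ⌊latY z⌋ - 1) ≤ 1 / 3 then (⌊latX z⌋, ⌊latY z⌋ + 1)
  else (⌊latX z⌋ + 1, ⌊latY z⌋ + 1)

/-- The chosen lattice point is within form-distance `1/3` in lattice coordinates. -/
theorem errF_hexRound_le (z : ℂ) :
    errF (latX z - ((hexRound z).1 : ℝ)) (latY z - ((hexRound z).2 : ℝ)) ≤ 1 / 3 := by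
  have hx0 : 0 ≤ latX z - ⌊latX z⌋ := by linarith [Int.floor_le (latX z)]
  have hx1 : latX z - ⌊latX z⌋ ≤ 1 := by linarith [Int.lt_floor_add_one (latX z)]
  have hy0 : 0 ≤ latY z - ⌊latY z⌋ := by linarith [Int.floor_le (latY z)]
  have hy1 : latY z - ⌊latY z⌋ ≤ 1 := by linarith [Int.lt_floor_add_one (latY z)]
  unfold hexRound
  split_ifs with h1 h2 h3
  · simpa using h1
  · push_cast; convert h2 using 2; ring
  · push_cast; convert h3 using 2; ring
  · push_cast
    -- none of the first three corners works: then `a + b ≥ 1` (lower-triangle lemma) and the corner `(1,1)` works (upper-triangle lemma)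
    have hab : 1 ≤ (latX z - ⌊latX z⌋) + (latY z - ⌊latY z⌋) := by
      by_contra hlt
      push Not at hlt
      rcases min3_errF_le _ _ hx0 hy0 hlt.le with h | h | h
      · exact h1 h
      · exact h2 h
      · exact h3 h
    rcases min3_errF_le' _ _ hx1 hy1 hab with h | h | h
    · convert h using 2 <;> ring
    · exact absurd h h3
    · exact absurd h h2

/-- The chosen lattice point of `z` as a point of the plane. -/
noncomputable def hexPt (z : ℂ) : ℂ := latC ((hexRound z).1 : ℝ) ((hexRound z).2 : ℝ)

/-- Every point is within squared distance `d²/3 = 3/16` of its lattice point. -/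
theorem normSq_sub_hexPt_le (z : ℂ) : Complex.normSq (z - hexPt z) ≤ 3 / 16 := by
  have h := errF_hexRound_le z
  have e : z - hexPt z = latC (latX z - ((hexRound z).1 : ℝ)) (latY z - ((hexRound z).2 : ℝ)) := by
    rw [← latC_sub, latC_latX_latY]; rfl
  rw [e, normSq_latC]
  have : dHex ^ 2 = 9 / 16 := by norm_num [dHex]
  rw [this]
  nlinarith [h]

/-- THE COLOURING: `z ↦ (m − 2n) mod 7` for its lattice point `d(m + nω)`. -/
noncomputable def hexColour (z : ℂ) : ZMod 7 := (((hexRound z).1 - 2 * (hexRound z).2 : ℤ) : ZMod 7)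

/-- Number theory of the index-7 sublattice `(2 + ω)ℤ[ω]`: `7 ∣ p − 2q` and `(p, q) ≠ 0` force `p² + pq + q² ≥ 7`. -/
theorem seven_le_form {p q : ℤ} (h : (7 : ℤ) ∣ p - 2 * q) (hne : ¬ (p = 0 ∧ q = 0)) : 7 ≤ p * p + p * q + q * q := by
  obtain ⟨k, hk⟩ := h
  have hp : p = 2 * q + 7 * k := by linarith
  subst hp
  have hform : (2 * q + 7 * k) * (2 * q + 7 * k) + (2 * q + 7 * k) * q + q * q = 7 * (q * q + 5 * k * q + 7 * k * k) := by ring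
  rw [hform]
  suffices h1 : 1 ≤ q * q + 5 * k * q + 7 * k * k by linarith
  by_cases hk0 : k = 0
  · subst hk0
    have hq : q ≠ 0 := by
      rintro rfl; exact hne ⟨by ring, rfl⟩
    rcases lt_or_gt_of_ne hq with hq' | hq'
    · nlinarith
    · nlinarith
  · rcases lt_or_gt_of_ne hk0 with hk' | hk'
    · nlinarith [sq_nonneg (2 * q + 5 * k)]
    · nlinarith [sq_nonneg (2 * q + 5 * k)]

/-- Squared distance of two lattice points `d(m + nω)`, `d(m' + n'ω)`. -/
theorem normSq_latC_int (m n m' n' : ℤ) :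
    Complex.normSq (latC (m : ℝ) (n : ℝ) - latC (m' : ℝ) (n' : ℝ)) =
      dHex ^ 2 * (((m - m') * (m - m') + (m - m') * (n - n') + (n - n') * (n - n') : ℤ) : ℝ) := by
  rw [latC_sub, normSq_latC, errF]; push_cast; ring

/-- KEY PROPERTY: two points at distance `1` get different colours. -/
theorem hexColour_ne_of_norm_eq_one {z w : ℂ} (hzw : ‖z - w‖ = 1) : hexColour z ≠ hexColour w := by
  intro heq
  -- notation
  set m := (hexRound z).1 with hm
  set n := (hexRound z).2 with hn
  set m' := (hexRound w).1 with hm'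
  set n' := (hexRound w).2 with hn'
  have hdvd : (7 : ℤ) ∣ (m - m') - 2 * (n - n') := by
    have h7 := (ZMod.intCast_eq_intCast_iff_dvd_sub (m' - 2 * n') (m - 2 * n) 7).1 (by simpa [hexColour] using heq.symm)
    have e : (m - 2 * n) - (m' - 2 * n') = (m - m') - 2 * (n - n') := by ring
    rw [← e]; exact_mod_cast h7
  have hA : Complex.normSq (z - hexPt z) ≤ 3 / 16 := normSq_sub_hexPt_le z
  have hB : Complex.normSq (w - hexPt w) ≤ 3 / 16 := normSq_sub_hexPt_le w
  rw [← norm_sq_eq_normSq] at hA hB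
  have hA0 := norm_nonneg (z - hexPt z)
  have hB0 := norm_nonneg (w - hexPt w)
  by_cases h0 : m - m' = 0 ∧ n - n' = 0
  · -- same lattice point: `‖z − w‖ ≤ ‖z − ℓ‖ + ‖ℓ − w‖ < 1`
    have hpt : hexPt z = hexPt w := by
      simp only [hexPt]
      rw [← hm, ← hn, ← hm', ← hn', show m = m' by linarith [h0.1], show n = n' by linarith [h0.2]]
    have htri : ‖z - w‖ ≤ ‖z - hexPt z‖ + ‖w - hexPt w‖ := by
      have := norm_sub_le (z - hexPt z) (w - hexPt w)
      rw [hpt] at this ⊢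
      have e : z - hexPt w - (w - hexPt w) = z - w := by ring
      rw [e] at this; exact this
    have h1 : (1 : ℝ) ≤ ‖z - hexPt z‖ + ‖w - hexPt w‖ := by linarith
    nlinarith [mul_le_mul h1 h1 zero_le_one (by linarith), sq_nonneg (‖z - hexPt z‖ - ‖w - hexPt w‖)]
  · -- different lattice points: far apart
    have hL : 63 / 16 ≤ Complex.normSq (hexPt z - hexPt w) := by
      have h7 := seven_le_form hdvd h0
      have h7' : (7 : ℝ) ≤ (((m - m') * (m - m') + (m - m') * (n - n') + (n - n') * (n - n') : ℤ) : ℝ) := by exact_mod_cast h7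
      simp only [hexPt]
      rw [← hm, ← hn, ← hm', ← hn', normSq_latC_int]
      have : dHex ^ 2 = 9 / 16 := by norm_num [dHex]
      rw [this]; nlinarith [h7']
    rw [← norm_sq_eq_normSq] at hL
    have hL0 := norm_nonneg (hexPt z - hexPt w)
    have htri : ‖hexPt z - hexPt w‖ ≤ ‖z - hexPt z‖ + ‖z - w‖ + ‖w - hexPt w‖ := by
      have e : hexPt z - hexPt w = -(z - hexPt z) + (z - w) + (w - hexPt w) := by ring
      rw [e]
      refine (norm_add_le _ _).trans ?_
      refine add_le_add ((norm_add_le _ _).trans ?_) le_rfl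
      rw [norm_neg]
    rw [hzw] at htri
    set A := ‖z - hexPt z‖ with hAdef
    set B := ‖w - hexPt w‖ with hBdef
    set L := ‖hexPt z - hexPt w‖ with hLdef
    have h1 : (63 / 16 : ℝ) ≤ (A + 1 + B) * (A + 1 + B) := by nlinarith [mul_le_mul htri htri hL0 (by linarith)]
    have h2 : (A + B) * (A + B) ≤ 3 / 4 := by nlinarith [sq_nonneg (A - B)]
    have h3 : A * B ≤ 3 / 16 := by nlinarith [sq_nonneg (A - B)]
    have h4 : 35 / 32 ≤ A + B := by nlinarith [h1, h3, hA, hB]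
    nlinarith [h2, mul_le_mul h4 h4 (by norm_num) (by linarith)]

/-- The hexagonal 7-colouring of the unit-distance graph of `ℂ`. -/
noncomputable def hexColouringC : planeGraphC.Coloring (ZMod 7) :=
  SimpleGraph.Coloring.mk hexColour fun h => hexColour_ne_of_norm_eq_one h

/-- The unit-distance graph of `ℂ` is 7-colourable. -/
theorem planeC_colorable_seven : planeGraphC.Colorable 7 := by
  simpa using hexColouringC.colorable

/-- `χ(ℝ²) ≤ 7`: the unit-distance graph of the Euclidean plane is 7-colourable (kernel; hexagonal colouring). -/
theorem plane_colorable_seven : planeUnitDistanceGraph.Colorable 7 := by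
  obtain ⟨C⟩ := planeC_colorable_seven
  let e : ℂ ≃ₗᵢ[ℝ] EuclideanSpace ℝ (Fin 2) := Complex.orthonormalBasisOneI.repr
  refine ⟨SimpleGraph.Coloring.mk (fun x => C (e.symm x)) ?_⟩
  intro x y hxy
  apply C.valid
  show ‖e.symm x - e.symm y‖ = 1
  rw [← map_sub, LinearIsometryEquiv.norm_map, ← dist_eq_norm]
  exact hxy

/-- `χ(ℝ²) ≤ 7` in the chromatic-number form. -/
theorem chromaticNumber_plane_le_seven : planeUnitDistanceGraph.chromaticNumber ≤ 7 :=
  plane_colorable_seven.chromaticNumber_le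

/-- THE KNOWN RANGE OF THE HADWIGER–NELSON PROBLEM, KERNEL-CHECKED: `5 ≤ χ(ℝ²) ≤ 7` (de Grey 2018 / Isbell 1950). -/
theorem plane_chromaticNumber_bounds :
    5 ≤ planeUnitDistanceGraph.chromaticNumber ∧ planeUnitDistanceGraph.chromaticNumber ≤ 7 :=
  ⟨five_le_chromaticNumber_plane, chromaticNumber_plane_le_seven⟩

end Summit.Ventures.DiscreteObjects.UnitDistance
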